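import Mathlib
import HarnessLib

/-!
# Cyclic reflections commute with `τ`, preserve `B`, fix the `τ`-invariants, and are unique
# (Carlson–Toledo 1999, §6 Proposition 2) — packaging, part 6a

Family `hodge`, layer `Literature/AlgebraicGeometry/HodgeTheory`. THEOREMS only, rational level, for crux K1
of `Summits/HodgeConjecture/HodgeConjecture/Theses/CyclicUnitaryPowers.lean` (lane D glue
`stub_unitaryCommutatorsInMon_of_facts`).  Statement D presents each generator of the monodromy group by two
clauses: `r = τ` on the cyclic span `W = span_ℚ {τ^i δ}` of a vanishing vector `δ` and `r x = x` for every `x`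
(left-)orthogonal to `W`.  From these clauses and `V = W ⊕ W^⊥` (`B` symmetric, non-degenerate on `W`) we
derive what the per-eigenspace restriction `ρ_j : Γ → GL(E_j)` needs: `r ∘ τ = τ ∘ r` (so `Γ` preserves the
eigenspaces of `τ ⊗ ℂ`), `r` is a `B`-isometry (so `Γ ⊆ O(B)`), `r` fixes the `τ`-invariants
(`H(1) ⊆ W^⊥` because `Σ_{i<p} τ^i δ = 0`; so `Γ` acts trivially on `H(1)`), `r` is determined by `δ`, and
these properties pass to the group `Subgroup.closure` generated by such `r`.
Written by the prover seat `hodge-nonav-prover-Ax`.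

## References
* [CarlsonToledo1999] J. A. Carlson, D. Toledo, *Discriminant complements and kernels of monodromy
  representations*, Duke Math. J. 97 (1999), §6 Proposition 2 (p. 14): "`T_δ` … is `τ` on `V(δ)` and the
  identity on `V(δ)^⊥`"; §3 (p. 7) (the monodromy group is generated by the `T_δ`).
-/

noncomputable section

open Module

namespace Literature.AlgebraicGeometry.HodgeTheory

universe v

variable {V : Type v} [AddCommGroup V] [Module ℚ V]

/-! ### §1 The cyclic span is `τ`-stable, and so is its orthogonal -/

/-- `τ^n x ∈ W` for `x ∈ W = span_ℚ {τ^i δ}`. [cite: CarlsonToledo1999, §6 (p. 13)] -/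
theorem pow_apply_mem_span_pow_apply {τ : V →ₗ[ℚ] V} {δ : V} (n : ℕ) {x : V}
    (hx : x ∈ Submodule.span ℚ (Set.range fun i : ℕ => (τ ^ i) δ)) :
    (τ ^ n) x ∈ Submodule.span ℚ (Set.range fun i : ℕ => (τ ^ i) δ) := by
  have h : Submodule.map (τ ^ n) (Submodule.span ℚ (Set.range fun i : ℕ => (τ ^ i) δ)) ≤
      Submodule.span ℚ (Set.range fun i : ℕ => (τ ^ i) δ) := by
    refine (Submodule.map_span_le _ _ _).2 ?_
    rintro _ ⟨i, rfl⟩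
    rw [← Module.End.mul_apply, ← pow_add]
    exact Submodule.subset_span ⟨n + i, rfl⟩
  exact h (Submodule.mem_map_of_mem hx)

/-- `τ x ∈ W` for `x ∈ W`. [cite: CarlsonToledo1999, §6 (p. 13)] -/
theorem apply_mem_span_pow_apply {τ : V →ₗ[ℚ] V} {δ : V} {x : V}
    (hx : x ∈ Submodule.span ℚ (Set.range fun i : ℕ => (τ ^ i) δ)) :
    τ x ∈ Submodule.span ℚ (Set.range fun i : ℕ => (τ ^ i) δ) := by
  simpa using pow_apply_mem_span_pow_apply (τ := τ) 1 hx

/-- Iterated isometry: `B(τ^n x, τ^n y) = B(x, y)`. [cite: CarlsonToledo1999, §6 (p. 13)] -/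
theorem pow_isometry {B : LinearMap.BilinForm ℚ V} {τ : V →ₗ[ℚ] V} (hτB : ∀ v w, B (τ v) (τ w) = B v w)
    (n : ℕ) (x y : V) : B ((τ ^ n) x) ((τ ^ n) y) = B x y := by
  induction n with
  | zero => simp
  | succ n ih => rw [pow_succ', Module.End.mul_apply, Module.End.mul_apply, hτB, ih]

/-- The (left) orthogonal of the cyclic span is `τ`-stable: if `B(u, W) = 0` then `B(τu, W) = 0`
(`τ` a `B`-isometry of finite order `p`, so `W = τ W`). [cite: CarlsonToledo1999, §6 (p. 13)] -/
theorem isOrtho_apply_of_isOrtho {B : LinearMap.BilinForm ℚ V} {τ : V →ₗ[ℚ] V} {p : ℕ} (hp : 0 < p)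
    (hτ : τ ^ p = 1) (hτB : ∀ v w, B (τ v) (τ w) = B v w) {δ u : V}
    (hu : ∀ y ∈ Submodule.span ℚ (Set.range fun i : ℕ => (τ ^ i) δ), B u y = 0)
    (y : V) (hy : y ∈ Submodule.span ℚ (Set.range fun i : ℕ => (τ ^ i) δ)) : B (τ u) y = 0 := by
  -- `y = τ (τ^{p-1} y)` with `τ^{p-1} y ∈ W`
  have hy' : y = τ ((τ ^ (p - 1)) y) := by
    rw [← Module.End.mul_apply, ← pow_succ', Nat.sub_add_cancel hp, hτ, Module.End.one_apply]
  rw [hy', hτB]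
  exact hu _ (pow_apply_mem_span_pow_apply (p - 1) hy)

/-! ### §2 The decomposition `V = W ⊕ W^⊥` -/

/-- **`V = W ⊕ W^⊥`**: every `x` is `w + u` with `w ∈ W` and `u` (left-)orthogonal to `W`, for `B` symmetric
and non-degenerate on the finite-dimensional `W` ("`H^{n+1}(Y)` splits orthogonally as `V ⊕ V^⊥`").
[cite: CarlsonToledo1999, §6 (p. 13)] -/
theorem exists_add_isOrtho [Module.Finite ℚ V] {B : LinearMap.BilinForm ℚ V} (hB : B.IsSymm)
    {W : Submodule ℚ V} (hnd : ∀ x ∈ W, (∀ y ∈ W, B x y = 0) → x = 0) (x : V) :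
    ∃ w ∈ W, ∃ u : V, (∀ y ∈ W, B u y = 0) ∧ x = w + u := by
  have hres : (B.restrict W).Nondegenerate := by
    refine ⟨fun m hm => ?_, fun m hm => ?_⟩
    · refine Subtype.ext (hnd m m.2 fun y hy => ?_)
      have h := hm ⟨y, hy⟩
      simpa using h
    · refine Subtype.ext (hnd m m.2 fun y hy => ?_)
      have h := hm ⟨y, hy⟩
      rw [hB.eq]
      simpa using h
  have hc : IsCompl W (B.orthogonal W) :=
    LinearMap.BilinForm.isCompl_orthogonal_of_restrict_nondegenerate hB.isRefl hres
  have hx : x ∈ W ⊔ B.orthogonal W := by rw [hc.sup_eq_top]; trivial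
  obtain ⟨w, hw, u, hu, rfl⟩ := Submodule.mem_sup.1 hx
  refine ⟨w, hw, u, fun y hy => ?_, rfl⟩
  rw [hB.eq]
  exact (LinearMap.BilinForm.mem_orthogonal_iff.1 hu) y hy

/-! ### §3 Cyclic reflections: commutation, isometry, invariants, uniqueness -/

section Reflection

variable [Module.Finite ℚ V] {B : LinearMap.BilinForm ℚ V} {τ r : V →ₗ[ℚ] V} {p : ℕ} {δ : V}

/-- **A cyclic reflection commutes with `τ`**: `r (τ x) = τ (r x)` (`r = τ` on `W`, `= id` on `W^⊥`, both
`τ`-stable). [cite: CarlsonToledo1999, §6 Proposition 2 (p. 14)] -/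
theorem cyclicReflection_comm (hB : B.IsSymm) (hp : 0 < p) (hτ : τ ^ p = 1)
    (hτB : ∀ v w, B (τ v) (τ w) = B v w)
    (hnd : ∀ x ∈ Submodule.span ℚ (Set.range fun i : ℕ => (τ ^ i) δ),
      (∀ y ∈ Submodule.span ℚ (Set.range fun i : ℕ => (τ ^ i) δ), B x y = 0) → x = 0)
    (hr1 : ∀ x ∈ Submodule.span ℚ (Set.range fun i : ℕ => (τ ^ i) δ), r x = τ x)
    (hr2 : ∀ x, (∀ y ∈ Submodule.span ℚ (Set.range fun i : ℕ => (τ ^ i) δ), B x y = 0) → r x = x)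
    (x : V) : r (τ x) = τ (r x) := by
  obtain ⟨w, hw, u, hu, rfl⟩ := exists_add_isOrtho hB hnd x
  have hτw := apply_mem_span_pow_apply (τ := τ) hw
  have hτu := isOrtho_apply_of_isOrtho hp hτ hτB hu
  rw [map_add, map_add, map_add, hr1 _ hτw, hr2 _ hτu, map_add, hr1 _ hw, hr2 _ hu]

/-- **A cyclic reflection is a `B`-isometry**: `B(r x, r y) = B(x, y)`.
[cite: CarlsonToledo1999, §6 Proposition 2 (p. 14)] -/
theorem cyclicReflection_isometry (hB : B.IsSymm) (hτB : ∀ v w, B (τ v) (τ w) = B v w)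
    (hnd : ∀ x ∈ Submodule.span ℚ (Set.range fun i : ℕ => (τ ^ i) δ),
      (∀ y ∈ Submodule.span ℚ (Set.range fun i : ℕ => (τ ^ i) δ), B x y = 0) → x = 0)
    (hr1 : ∀ x ∈ Submodule.span ℚ (Set.range fun i : ℕ => (τ ^ i) δ), r x = τ x)
    (hr2 : ∀ x, (∀ y ∈ Submodule.span ℚ (Set.range fun i : ℕ => (τ ^ i) δ), B x y = 0) → r x = x)
    (x y : V) : B (r x) (r y) = B x y := by
  obtain ⟨w, hw, u, hu, rfl⟩ := exists_add_isOrtho hB hnd x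
  obtain ⟨w', hw', u', hu', rfl⟩ := exists_add_isOrtho hB hnd y
  have hτw := apply_mem_span_pow_apply (τ := τ) hw
  have hτw' := apply_mem_span_pow_apply (τ := τ) hw'
  have hrx : r (w + u) = τ w + u := by rw [map_add, hr1 _ hw, hr2 _ hu]
  have hry : r (w' + u') = τ w' + u' := by rw [map_add, hr1 _ hw', hr2 _ hu']
  rw [hrx, hry]
  simp only [map_add, LinearMap.add_apply]
  rw [hτB, hu _ hτw', hu _ hw', hB.eq (τ w) u', hu' _ hτw, hB.eq w u', hu' _ hw]

omit [Module.Finite ℚ V] in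
/-- **The `τ`-invariants are orthogonal to every cyclic span**: `τ v = v` implies `B(v, τ^i δ) = B(v, δ)` and
`p · B(v, δ) = B(v, Σ τ^i δ) = 0`. [cite: CarlsonToledo1999, §6 (p. 13)] -/
theorem isOrtho_of_apply_eq_self (hp : 0 < p) (hτB : ∀ v w, B (τ v) (τ w) = B v w)
    (hsum : ∑ i ∈ Finset.range p, (τ ^ i) δ = 0) {v : V} (hv : τ v = v)
    (y : V) (hy : y ∈ Submodule.span ℚ (Set.range fun i : ℕ => (τ ^ i) δ)) : B v y = 0 := by
  have hvn : ∀ n : ℕ, (τ ^ n) v = v := by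
    intro n
    induction n with
    | zero => simp
    | succ n ih => rw [pow_succ, Module.End.mul_apply, hv, ih]
  have hi : ∀ i : ℕ, B v ((τ ^ i) δ) = B v δ := by
    intro i
    conv_lhs => rw [← hvn i]
    exact pow_isometry hτB i v δ
  have hδ : B v δ = 0 := by
    have h := congrArg (B v) hsum
    rw [map_sum, map_zero] at h
    simp only [hi, Finset.sum_const, Finset.card_range, nsmul_eq_mul] at h
    exact (mul_eq_zero.1 h).resolve_left (by exact_mod_cast hp.ne')
  have hle : Submodule.span ℚ (Set.range fun i : ℕ => (τ ^ i) δ) ≤ LinearMap.ker (B v) := by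
    refine Submodule.span_le.2 ?_
    rintro _ ⟨i, rfl⟩
    rw [SetLike.mem_coe, LinearMap.mem_ker, hi, hδ]
  exact hle hy

omit [Module.Finite ℚ V] in
/-- **A cyclic reflection fixes the `τ`-invariants** (`H(1) ⊆ W^⊥`): the monodromy group acts trivially on
`H(1)`. [cite: CarlsonToledo1999, §6 Proposition 2 (p. 14)] -/
theorem cyclicReflection_apply_of_apply_eq_self (hp : 0 < p) (hτB : ∀ v w, B (τ v) (τ w) = B v w)
    (hsum : ∑ i ∈ Finset.range p, (τ ^ i) δ = 0)
    (hr2 : ∀ x, (∀ y ∈ Submodule.span ℚ (Set.range fun i : ℕ => (τ ^ i) δ), B x y = 0) → r x = x)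
    {v : V} (hv : τ v = v) : r v = v :=
  hr2 v (isOrtho_of_apply_eq_self hp hτB hsum hv)

omit [Module.Finite ℚ V] in
/-- On the vanishing vector itself `r δ = τ δ`. [cite: CarlsonToledo1999, §6 Proposition 2 (p. 14)] -/
theorem cyclicReflection_apply_self
    (hr1 : ∀ x ∈ Submodule.span ℚ (Set.range fun i : ℕ => (τ ^ i) δ), r x = τ x) : r δ = τ δ :=
  hr1 δ (Submodule.subset_span ⟨0, by simp⟩)

/-- **Uniqueness**: the two clauses determine the cyclic reflection (`V = W ⊕ W^⊥`).
[cite: CarlsonToledo1999, §6 Proposition 2 (p. 14)] -/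
theorem cyclicReflection_unique {r' : V →ₗ[ℚ] V} (hB : B.IsSymm)
    (hnd : ∀ x ∈ Submodule.span ℚ (Set.range fun i : ℕ => (τ ^ i) δ),
      (∀ y ∈ Submodule.span ℚ (Set.range fun i : ℕ => (τ ^ i) δ), B x y = 0) → x = 0)
    (hr1 : ∀ x ∈ Submodule.span ℚ (Set.range fun i : ℕ => (τ ^ i) δ), r x = τ x)
    (hr2 : ∀ x, (∀ y ∈ Submodule.span ℚ (Set.range fun i : ℕ => (τ ^ i) δ), B x y = 0) → r x = x)
    (hr1' : ∀ x ∈ Submodule.span ℚ (Set.range fun i : ℕ => (τ ^ i) δ), r' x = τ x)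
    (hr2' : ∀ x, (∀ y ∈ Submodule.span ℚ (Set.range fun i : ℕ => (τ ^ i) δ), B x y = 0) → r' x = x) :
    r = r' := by
  refine LinearMap.ext fun x => ?_
  obtain ⟨w, hw, u, hu, rfl⟩ := exists_add_isOrtho hB hnd x
  rw [map_add, map_add, hr1 _ hw, hr2 _ hu, hr1' _ hw, hr2' _ hu]

end Reflection

/-! ### §4 Passing to the generated group -/

/-- Commutation with `τ` and `B`-isometry pass from generators to the generated subgroup of `GL(V)`: every
element of `Subgroup.closure S` commutes with `τ` and preserves `B` if every `s ∈ S` does (the monodromy group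
is generated by the cyclic reflections). [cite: CarlsonToledo1999, §3 (p. 7) and §6 Proposition 2 (p. 14)] -/
theorem comm_and_isometry_of_mem_closure {K : Type*} [Field K] {M : Type*} [AddCommGroup M] [Module K M]
    (B : LinearMap.BilinForm K M) (τ : M → M) {S : Set (M ≃ₗ[K] M)}
    (hS : ∀ s ∈ S, (∀ x, s (τ x) = τ (s x)) ∧ ∀ x y, B (s x) (s y) = B x y)
    {γ : M ≃ₗ[K] M} (hγ : γ ∈ Subgroup.closure S) :
    (∀ x, γ (τ x) = τ (γ x)) ∧ ∀ x y, B (γ x) (γ y) = B x y := by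
  induction hγ using Subgroup.closure_induction with
  | mem s hs => exact hS s hs
  | one => exact ⟨fun x => rfl, fun x y => rfl⟩
  | mul g g' _ _ hg hg' =>
    refine ⟨fun x => ?_, fun x y => ?_⟩
    · rw [LinearEquiv.mul_apply, LinearEquiv.mul_apply, hg'.1, hg.1]
    · rw [LinearEquiv.mul_apply, LinearEquiv.mul_apply, hg.2, hg'.2]
  | inv g _ hg =>
    refine ⟨fun x => ?_, fun x y => ?_⟩
    · apply g.injective
      show g (g.symm (τ x)) = g (τ (g.symm x))
      rw [g.apply_symm_apply, hg.1, g.apply_symm_apply]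
    · show B (g.symm x) (g.symm y) = B x y
      conv_rhs => rw [← g.apply_symm_apply x, ← g.apply_symm_apply y]
      exact (hg.2 _ _).symm

end Literature.AlgebraicGeometry.HodgeTheory

end
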